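import Mathlib.Analysis.Normed.Module.Basic
import Literature.AlgebraicTopology.Homotopy.GenLoopPaths
import HarnessLib

/-!
# Homotopy extension for cubes: box filling, HEP for `(Iᴺ, ∂Iᴺ)`, and free-vs-relative homotopies

Topic `Literature/AlgebraicTopology/Homotopy`. Elementary homotopy theory of the cube
`Iᴺ = (N → I)` (Mathlib's model for `GenLoop`/`HomotopyGroup`), absent from Mathlib, all PROVED:

* `Literature.AlgebraicTopology.Homotopy.CubeHEP.fill` and `fill_continuousOn`: the radial
  projection of the solid box `D × [0, τ]` (`D` the closed unit ball of a real normed space `E`)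
  from the apex `(0, 2τ)` onto `D × {0} ∪ ∂D × [0, τ]` (Hatcher, *Algebraic Topology* (2002),
  Prop. 0.16: "`Dⁿ × I` retracts onto `Dⁿ × {0} ∪ ∂Dⁿ × I`"), generalising
  `Literature.AlgebraicTopology.Homotopy.WhiteheadCW.boxFill` (same formula, there for `E = ℝᵐ` with the sup norm) to an
  arbitrary real normed space;
* `Literature.AlgebraicTopology.Homotopy.CubeHEP.BallChart`: a space `K` identified with the closed unit ball of `E`
  (`Iᴺ ≅ [-1, 1]ᴺ ⊆ ℝᴺ`, `I × Iᴺ ≅ [-1, 1] × [-1, 1]ᴺ ⊆ ℝ × ℝᴺ`, sup norms), with its boundary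
  `∂K` = preimage of the unit sphere; `BallChart.exists_extension`: the **homotopy extension
  property** of `(K, ∂K)` — a map `φ : K → Z` and a homotopy `h` of `φ|∂K` extend to a homotopy
  of `φ` (Hatcher 2002, Prop. 0.16 and p. 15);
* the two charts `BallChart.cube N` (`K = Iᴺ`, `∂K = Cube.boundary N`) and
  `BallChart.cylinder N` (`K = I × Iᴺ`, `∂K = GenLoopPath.cylBd N = {0, 1} × Iᴺ ∪ I × ∂Iᴺ`);
* `Literature.AlgebraicTopology.Homotopy.CubeHEP.homotopicRel_of_freeHomotopy`: if `u, v : Iᴺ → Z` are joined by a free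
  homotopy `Φ` and the track of `Φ` on `∂Iᴺ` is null-homotopic rel endpoints (through maps
  which at both ends of the deformation and at both ends of the track are `u|∂Iᴺ`), then `u`
  and `v` are homotopic rel `∂Iᴺ` — one application of the HEP of the cylinder
  `(I × Iᴺ, ∂(I × Iᴺ))`. This is the mechanism behind the change-of-basepoint isomorphisms
  `β_γ` of Hatcher §4.1 (p. 341) and is used in that role by the sibling files on `n`-connected
  maps and Whitehead's theorem.

Partial maps (data on `∂K` only) are represented, as in `WhiteheadCWContractible.lean`, by total
functions with `ContinuousOn` hypotheses on the relevant closed set.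

## Deduplication plan (owner: librarian, refactor events 197556 / 207272)

This Mathlib-only file is the intended single home of three blocks that exist in the tree in
special cases; the refactor (the two older files import this one and replace their copies by
these declarations, as aliases where the old names are consumed) is filed as librarian event
197556:

* `CubeHEP.fill`, `fill_bottom`, `fill_side`, `fill_continuousOn` (real normed space `E`, time
  `τ`) SUPERSEDE `WhiteheadCW.boxFill`, `boxFill_bottom`, `boxFill_side`, `boxFill_continuousOn`
  of `WhiteheadCWContractible.lean` (`E = ℝᵐ`; same formula and proof);
* `CubeHEP.cubeToBall`, `ballToCube`, `continuous_cubeToBall`, `continuous_ballToCube`,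
  `ballToCube_cubeToBall`, `cubeToBall_mem_closedBall`, `cubeToBall_ballToCube`,
  `mem_boundary_iff_norm_cubeToBall` (finite index type `N`) SUPERSEDE `WhiteheadCW.cubeToBall`,
  `ballToCube`, `continuous_cubeToBall`, `continuous_ballToCube`, `cubeToBall_mem_closedBall`,
  `cubeToBall_mem_sphere`, `cubeToBall_ballToCube`, `ballToCube_mem_boundary` of
  `WhiteheadCWContractible.lean` (`N = Fin m`);
* `CubeHEP.isClosed_cubeBoundary`, `CubeHEP.isClosed_cylBd` together with the set
  `GenLoopPath.cylBd` of `GenLoopPaths.lean` (imported and used here for the boundary of the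
  cylinder; no copy is made) SUPERSEDE `Literature.AlgebraicTopology.Homotopy.isClosed_cubeBoundary`, `cylBoundary`,
  `isClosed_cylBoundary` of `HomotopyGroupsGeneralPosition.lean` (`cylBoundary` is the same set
  written as a union of three sets, definitionally equal to `GenLoopPath.cylBd`), whose heavy
  analytic imports are unwanted in these foundational files (dedup plan: librarian events 197556 and
  its amendment 207272).

## References

* A. Hatcher, *Algebraic Topology*, CUP (2002), Prop. 0.16 and the paragraph after it (HEP for
  `(Dⁿ, ∂Dⁿ)` by radial projection), §4.1 p. 341 (change of basepoint). [HatcherAT2002]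
-/

noncomputable section

open Set Metric unitInterval Function
open scoped Topology Topology.Homotopy

namespace Literature.AlgebraicTopology.Homotopy

namespace CubeHEP

/-! ### Box filling in a real normed space -/

section Fill

variable {E : Type*} [NormedAddCommGroup E] [NormedSpace ℝ E] {Z : Type*} [TopologicalSpace Z]

/-- `fill τ φ h (w, t)`: follow the ray from the apex `(0, 2τ)` through `(w, t)` down to the bottom
`D × {0}` (value `φ`) or out to the sides `∂D × [0, τ]` (value `h`), `D` the closed unit ball of
the real normed space `E` (Hatcher 2002, Prop. 0.16). Supersedes `WhiteheadCW.boxFill` (the same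
formula for `E = ℝᵐ`; dedup event 197556). [cite: HatcherAT2002, Prop. 0.16] -/
def fill (τ : ℝ) (φ : E → Z) (h : E × ℝ → Z) (p : E × ℝ) : Z :=
  if 2 * τ * ‖p.1‖ ≤ 2 * τ - p.2 then φ ((2 * τ / (2 * τ - p.2)) • p.1)
  else h (‖p.1‖⁻¹ • p.1, 2 * τ - (2 * τ - p.2) / ‖p.1‖)

variable {τ : ℝ} {φ : E → Z} {h : E × ℝ → Z}

omit [TopologicalSpace Z] in
/-- On the bottom `D × {0}` the filling is `φ` (supersedes `WhiteheadCW.boxFill_bottom`).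
[folklore] -/
theorem fill_bottom (hτ : 0 < τ) {w : E} (hw : w ∈ closedBall (0 : E) 1) :
    fill τ φ h (w, 0) = φ w := by
  have h2τ : (2 * τ) ≠ 0 := by positivity
  have hw1 : ‖w‖ ≤ 1 := mem_closedBall_zero_iff.1 hw
  have hc : 2 * τ * ‖w‖ ≤ 2 * τ - 0 := by nlinarith
  show (if 2 * τ * ‖w‖ ≤ 2 * τ - 0 then φ ((2 * τ / (2 * τ - 0)) • w)
    else h (‖w‖⁻¹ • w, 2 * τ - (2 * τ - 0) / ‖w‖)) = φ w
  rw [if_pos hc, sub_zero, div_self h2τ, one_smul]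

omit [TopologicalSpace Z] in
/-- On the sides `∂D × [0, τ]` the filling is `h` (supersedes `WhiteheadCW.boxFill_side`).
[folklore] -/
theorem fill_side (hτ : 0 < τ) (h0 : ∀ w ∈ sphere (0 : E) 1, h (w, 0) = φ w)
    {w : E} (hw : w ∈ sphere (0 : E) 1) {t : ℝ} (ht : t ∈ Icc 0 τ) :
    fill τ φ h (w, t) = h (w, t) := by
  have hw1 : ‖w‖ = 1 := mem_sphere_zero_iff_norm.1 hw
  have h2τ : (2 * τ) ≠ 0 := by positivity
  show (if 2 * τ * ‖w‖ ≤ 2 * τ - t then φ ((2 * τ / (2 * τ - t)) • w)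
    else h (‖w‖⁻¹ • w, 2 * τ - (2 * τ - t) / ‖w‖)) = h (w, t)
  by_cases hc : 2 * τ * ‖w‖ ≤ 2 * τ - t
  · have ht0 : t = 0 := by rw [hw1] at hc; linarith [ht.1]
    subst ht0
    rw [if_pos hc, sub_zero, div_self h2τ, one_smul]
    exact (h0 w hw).symm
  · rw [if_neg hc, hw1, inv_one, one_smul, div_one, sub_sub_cancel]

/-- The filling is continuous on the solid box `D × [0, τ]` (`0 < τ ≤ 1`) when `φ` is continuous
on `D`, `h` on `∂D × [0, 1]`, and they agree on the rim `∂D × {0}` (the two branches of the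
radial projection are continuous on closed pieces and agree on the interface; the proof of
`WhiteheadCW.boxFill_continuousOn` verbatim in a general normed space, which it supersedes).
[folklore] -/
theorem fill_continuousOn (hτ : 0 < τ) (hτ1 : τ ≤ 1) (hφ : ContinuousOn φ (closedBall 0 1))
    (hh : ContinuousOn h (sphere (0 : E) 1 ×ˢ Icc (0 : ℝ) 1))
    (h0 : ∀ w ∈ sphere (0 : E) 1, h (w, 0) = φ w) :
    ContinuousOn (fill τ φ h) (closedBall (0 : E) 1 ×ˢ Icc (0 : ℝ) τ) := by
  have hu : Continuous fun p : E × ℝ => 2 * τ * ‖p.1‖ := by fun_prop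
  have hv : Continuous fun p : E × ℝ => 2 * τ - p.2 := by fun_prop
  refine ContinuousOn.if ?_ ?_ ?_
  · -- the two branches agree on the interface
    rintro ⟨w, t⟩ ⟨⟨hw, ht⟩, hfr⟩
    have heq : 2 * τ * ‖w‖ = 2 * τ - t := frontier_le_subset_eq hu hv hfr
    have hpos : 0 < 2 * τ - t := by linarith [ht.2]
    have hwpos : 0 < ‖w‖ := by
      by_contra hcon
      have : ‖w‖ = 0 := le_antisymm (not_lt.1 hcon) (norm_nonneg _)
      rw [this, mul_zero] at heq
      linarith
    have hcoef : 2 * τ / (2 * τ - t) = ‖w‖⁻¹ := by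
      rw [div_eq_iff hpos.ne', ← heq]
      field_simp
    have hsph : ‖w‖⁻¹ • w ∈ sphere (0 : E) 1 := by
      rw [mem_sphere_zero_iff_norm, norm_smul, norm_inv, norm_norm, inv_mul_cancel₀ hwpos.ne']
    have hsec : 2 * τ - (2 * τ - t) / ‖w‖ = 0 := by
      rw [← heq, mul_div_assoc, div_self hwpos.ne', mul_one, sub_self]
    dsimp only
    rw [hcoef, hsec, h0 _ hsph]
  · -- bottom branch: `φ` after a rescaling staying in the ball
    have hcl : closure {p : E × ℝ | 2 * τ * ‖p.1‖ ≤ 2 * τ - p.2} =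
        {p | 2 * τ * ‖p.1‖ ≤ 2 * τ - p.2} := closure_le_eq hu hv
    rw [hcl]
    refine hφ.comp ?_ ?_
    · refine ContinuousOn.smul (ContinuousOn.div continuousOn_const hv.continuousOn ?_)
        continuousOn_fst
      rintro ⟨w, t⟩ ⟨⟨-, ht⟩, -⟩
      exact ne_of_gt (by dsimp only; linarith [ht.2])
    · rintro ⟨w, t⟩ ⟨⟨hw, ht⟩, hc⟩
      have hpos : 0 < 2 * τ - t := by linarith [ht.2]
      rw [mem_closedBall_zero_iff, norm_smul, Real.norm_eq_abs,
        abs_of_pos (div_pos (by positivity) hpos),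
        div_mul_eq_mul_div, div_le_one hpos]
      exact hc
  · -- side branch: `h` after the radial projection onto the sides
    have hcl : closure {p : E × ℝ | ¬ 2 * τ * ‖p.1‖ ≤ 2 * τ - p.2} ⊆
        {p | 2 * τ - p.2 ≤ 2 * τ * ‖p.1‖} := by
      have : {p : E × ℝ | ¬ 2 * τ * ‖p.1‖ ≤ 2 * τ - p.2} =
          {p | 2 * τ - p.2 < 2 * τ * ‖p.1‖} := by ext p; exact not_le
      rw [this]
      exact closure_lt_subset_le hv hu
    have hwpos : ∀ p : E × ℝ, p ∈ closedBall (0 : E) 1 ×ˢ Icc (0 : ℝ) τ ∩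
        closure {p : E × ℝ | ¬ 2 * τ * ‖p.1‖ ≤ 2 * τ - p.2} → 0 < ‖p.1‖ := by
      rintro ⟨w, t⟩ ⟨⟨hw, ht⟩, hc⟩
      have hc' : 2 * τ - t ≤ 2 * τ * ‖w‖ := hcl hc
      dsimp only at ht ⊢
      rcases (norm_nonneg w).eq_or_lt with hw0 | hw0
      · rw [← hw0, mul_zero] at hc'
        linarith [ht.2]
      · exact hw0
    refine hh.comp ?_ ?_
    · refine ContinuousOn.prodMk ?_ ?_
      · refine ContinuousOn.smul (ContinuousOn.inv₀
          ((continuous_norm.comp continuous_fst).continuousOn) ?_) continuousOn_fst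
        exact fun p hp => (hwpos p hp).ne'
      · refine ContinuousOn.sub continuousOn_const (ContinuousOn.div hv.continuousOn
          ((continuous_norm.comp continuous_fst).continuousOn) ?_)
        exact fun p hp => (hwpos p hp).ne'
    · rintro ⟨w, t⟩ hp
      have hw0 := hwpos _ hp
      obtain ⟨⟨hw, ht⟩, hc⟩ := hp
      have hc' : 2 * τ - t ≤ 2 * τ * ‖w‖ := hcl hc
      have hw1 : ‖w‖ ≤ 1 := mem_closedBall_zero_iff.1 hw
      dsimp only at hw0 hc' ⊢
      refine ⟨?_, ?_, ?_⟩
      · rw [mem_sphere_zero_iff_norm, norm_smul, norm_inv, norm_norm, inv_mul_cancel₀ hw0.ne']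
      · rw [sub_nonneg, div_le_iff₀ hw0]
        exact hc'
      · have h1 : 2 * τ - t ≤ (2 * τ - t) / ‖w‖ := by
          rw [le_div_iff₀ hw0]
          nlinarith [ht.2]
        linarith [ht.2]

end Fill

/-! ### Spaces charted by a ball, and their homotopy extension property -/

section Chart

variable (K : Type*) [TopologicalSpace K] (E : Type*) [NormedAddCommGroup E] [NormedSpace ℝ E]

/-- A **ball chart** on a space `K`: an identification of `K` with the closed unit ball `D` of a
real normed space `E` (`toFun : K → D` continuous, with a continuous retraction-inverse
`invFun : E → K`), together with the *boundary* `∂K = toFun⁻¹(∂D)`. Instances: the cube `Iᴺ`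
and the cylinder `I × Iᴺ` in `ℝᴺ`, `ℝ × ℝᴺ` with the sup norm. [folklore] -/
structure BallChart where
  /-- the chart `K → E`, onto the closed unit ball -/
  toFun : K → E
  /-- its inverse on the closed unit ball (any continuous extension to `E`) -/
  invFun : E → K
  continuous_toFun : Continuous toFun
  continuous_invFun : Continuous invFun
  left_inv : ∀ k, invFun (toFun k) = k
  mem_closedBall : ∀ k, toFun k ∈ closedBall (0 : E) 1
  right_inv : ∀ v ∈ closedBall (0 : E) 1, toFun (invFun v) = v
  /-- the boundary `∂K` -/
  boundary : Set K
  mem_boundary_iff : ∀ k, k ∈ boundary ↔ ‖toFun k‖ = 1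

variable {K E} {Z : Type*} [TopologicalSpace Z]

namespace BallChart

variable (c : BallChart K E)

omit [NormedSpace ℝ E] in
/-- Points of the sphere chart back into the boundary. [folklore] -/
theorem invFun_mem_boundary {v : E} (hv : v ∈ sphere (0 : E) 1) : c.invFun v ∈ c.boundary := by
  rw [c.mem_boundary_iff, c.right_inv v (sphere_subset_closedBall hv)]
  exact mem_sphere_zero_iff_norm.1 hv

omit [NormedSpace ℝ E] in
/-- Boundary points chart onto the sphere. [folklore] -/
theorem toFun_mem_sphere {k : K} (hk : k ∈ c.boundary) : c.toFun k ∈ sphere (0 : E) 1 :=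
  mem_sphere_zero_iff_norm.2 ((c.mem_boundary_iff k).1 hk)

/-- **Homotopy extension property of `(K, ∂K)`** for a ball chart (Hatcher 2002, Prop. 0.16 and
p. 15: `(Dⁿ, ∂Dⁿ)` has the HEP since `Dⁿ × I` retracts onto `Dⁿ × {0} ∪ ∂Dⁿ × I`): a map
`φ : K → Z` and a homotopy `h : I × K → Z` of `φ|∂K` (only its values on `I × ∂K` matter; it
must be continuous there and start at `φ`) extend to a homotopy `Φ` of `φ` agreeing with `h` on
`I × ∂K`. [cite: HatcherAT2002, Prop. 0.16] -/
theorem exists_extension (φ : C(K, Z)) (h : I × K → Z)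
    (hh : ContinuousOn h (univ ×ˢ c.boundary)) (h0 : ∀ k ∈ c.boundary, h (0, k) = φ k) :
    ∃ Φ : C(I × K, Z), (∀ k, Φ (0, k) = φ k) ∧ ∀ (t : I), ∀ k ∈ c.boundary, Φ (t, k) = h (t, k) := by
  -- the data in the chart
  set φ' : E → Z := fun v => φ (c.invFun v) with hφ'
  set h' : E × ℝ → Z := fun p => h (Set.projIcc 0 1 zero_le_one p.2, c.invFun p.1) with hh'
  have hφ'c : ContinuousOn φ' (closedBall 0 1) :=
    (φ.continuous.comp c.continuous_invFun).continuousOn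
  have hh'c : ContinuousOn h' (sphere (0 : E) 1 ×ˢ Icc (0 : ℝ) 1) := by
    refine hh.comp ((continuous_projIcc.comp continuous_snd).prodMk
      (c.continuous_invFun.comp continuous_fst)).continuousOn ?_
    rintro ⟨v, t⟩ ⟨hv, -⟩
    exact ⟨mem_univ _, c.invFun_mem_boundary hv⟩
  have h0' : ∀ w ∈ sphere (0 : E) 1, h' (w, 0) = φ' w := by
    intro w hw
    simp only [hh', hφ', Set.projIcc_left]
    exact h0 _ (c.invFun_mem_boundary hw)
  have hF := fill_continuousOn one_pos le_rfl hφ'c hh'c h0'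
  -- pull back along the chart
  have hmap : Continuous fun p : I × K => (c.toFun p.2, (p.1 : ℝ)) :=
    (c.continuous_toFun.comp continuous_snd).prodMk (continuous_subtype_val.comp continuous_fst)
  have hmem : ∀ p : I × K, (c.toFun p.2, (p.1 : ℝ)) ∈ closedBall (0 : E) 1 ×ˢ Icc (0 : ℝ) 1 :=
    fun p => ⟨c.mem_closedBall p.2, p.1.2.1, p.1.2.2⟩
  refine ⟨⟨fun p => fill 1 φ' h' (c.toFun p.2, (p.1 : ℝ)),
    hF.comp_continuous hmap hmem⟩, fun k => ?_, fun t k hk => ?_⟩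
  · show fill 1 φ' h' (c.toFun k, ((0 : I) : ℝ)) = φ k
    rw [Icc.coe_zero, fill_bottom one_pos (c.mem_closedBall k), hφ']
    simp only [c.left_inv]
  · show fill 1 φ' h' (c.toFun k, (t : ℝ)) = h (t, k)
    rw [fill_side one_pos h0' (c.toFun_mem_sphere hk) ⟨t.2.1, t.2.2⟩, hh']
    simp only [c.left_inv, Set.projIcc_val]

end BallChart

end Chart

/-! ### The cube `Iᴺ` and the cylinder `I × Iᴺ` as ball charts (sup norms) -/

section Cube

variable {N : Type*} [Fintype N] {Z : Type*} [TopologicalSpace Z]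

/-- The affine identification `Iᴺ → [-1, 1]ᴺ`, `y ↦ 2y - 1` (any finite index type `N`;
supersedes `WhiteheadCW.cubeToBall`, the case `N = Fin m`, dedup event 197556 — likewise the
lemmas below supersede the `WhiteheadCW` lemmas of the same names, with
`mem_boundary_iff_norm_cubeToBall` replacing `cubeToBall_mem_sphere`/`ballToCube_mem_boundary`).
[folklore] -/
def cubeToBall (y : N → I) : N → ℝ := fun i => 2 * (y i : ℝ) - 1

/-- The affine identification `[-1, 1]ᴺ → Iᴺ`, `v ↦ (v + 1)/2`, clamped outside the ball
(supersedes `WhiteheadCW.ballToCube`). [folklore] -/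
def ballToCube (v : N → ℝ) : N → I := fun i => Set.projIcc (0 : ℝ) 1 zero_le_one ((v i + 1) / 2)

omit [Fintype N] in
/-- `cubeToBall` is continuous. [folklore] -/
@[fun_prop]
theorem continuous_cubeToBall : Continuous (cubeToBall : (N → I) → N → ℝ) :=
  continuous_pi fun i => by unfold cubeToBall; fun_prop

omit [Fintype N] in
/-- `ballToCube` is continuous. [folklore] -/
@[fun_prop]
theorem continuous_ballToCube : Continuous (ballToCube : (N → ℝ) → N → I) :=
  continuous_pi fun i => continuous_projIcc.comp (by fun_prop)

omit [Fintype N] in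
/-- `ballToCube ∘ cubeToBall = id`. [folklore] -/
@[simp]
theorem ballToCube_cubeToBall (y : N → I) : ballToCube (cubeToBall y) = y := by
  funext i
  apply Subtype.ext
  have h : (2 * (y i : ℝ) - 1 + 1) / 2 = y i := by ring
  simp only [ballToCube, cubeToBall, h, Set.projIcc_val zero_le_one (y i)]

omit [Fintype N] in
/-- Each coordinate of `cubeToBall y` has absolute value `≤ 1`. [folklore] -/
theorem abs_cubeToBall_le (y : N → I) (i : N) : |cubeToBall y i| ≤ 1 := by
  rw [abs_le]
  simp only [cubeToBall]
  constructor <;> linarith [(y i).2.1, (y i).2.2]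

/-- `cubeToBall` lands in the closed unit ball (sup norm). [folklore] -/
theorem cubeToBall_mem_closedBall (y : N → I) : cubeToBall y ∈ closedBall (0 : N → ℝ) 1 := by
  rw [mem_closedBall_zero_iff, pi_norm_le_iff_of_nonneg zero_le_one]
  intro i
  rw [Real.norm_eq_abs]
  exact abs_cubeToBall_le y i

/-- `cubeToBall ∘ ballToCube = id` on the closed unit ball. [folklore] -/
theorem cubeToBall_ballToCube {v : N → ℝ} (hv : v ∈ closedBall (0 : N → ℝ) 1) :
    cubeToBall (ballToCube v) = v := by
  rw [mem_closedBall_zero_iff, pi_norm_le_iff_of_nonneg zero_le_one] at hv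
  funext i
  have hi := hv i
  rw [Real.norm_eq_abs, abs_le] at hi
  have hmem : (v i + 1) / 2 ∈ Icc (0 : ℝ) 1 := ⟨by linarith, by linarith⟩
  simp only [cubeToBall, ballToCube, Set.projIcc_of_mem _ hmem]
  ring

/-- A point of the cube lies on `∂Iᴺ` iff `cubeToBall` of it has sup norm `1`. [folklore] -/
theorem mem_boundary_iff_norm_cubeToBall (y : N → I) :
    y ∈ Cube.boundary N ↔ ‖cubeToBall y‖ = 1 := by
  constructor
  · rintro ⟨i, hi⟩
    refine le_antisymm (mem_closedBall_zero_iff.1 (cubeToBall_mem_closedBall y)) ?_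
    have h1 : ‖cubeToBall y i‖ = 1 := by
      rw [Real.norm_eq_abs]
      rcases hi with hi | hi
      · simp [cubeToBall, hi]
      · simp [cubeToBall, hi]; norm_num
    rw [← h1]
    exact norm_le_pi_norm (cubeToBall y) i
  · intro h1
    have hN : Nonempty N := by
      by_contra hcon
      rw [not_nonempty_iff] at hcon
      have : cubeToBall y = 0 := Subsingleton.elim _ _
      rw [this, norm_zero] at h1
      exact zero_ne_one h1
    obtain ⟨i, -, hi⟩ := Finset.exists_mem_eq_sup (Finset.univ : Finset N)
      Finset.univ_nonempty (fun j => ‖cubeToBall y j‖₊)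
    have hnorm : ‖cubeToBall y‖ = ‖cubeToBall y i‖ := by
      rw [Pi.norm_def]
      exact congrArg NNReal.toReal hi
    rw [h1, Real.norm_eq_abs] at hnorm
    refine ⟨i, ?_⟩
    simp only [cubeToBall] at hnorm
    rcases (abs_eq zero_le_one).1 hnorm.symm with h | h
    · right
      exact Subtype.ext (by rw [Icc.coe_one]; linarith)
    · left
      exact Subtype.ext (by rw [Icc.coe_zero]; linarith)

omit [Fintype N] in
/-- The boundary of the cube `Iᴺ` is closed, for `N` finite (supersedes
`Literature.AlgebraicTopology.Homotopy.isClosed_cubeBoundary` of `HomotopyGroupsGeneralPosition.lean`, same proof; dedup event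
197556). [folklore] -/
theorem isClosed_cubeBoundary [Finite N] : IsClosed (Cube.boundary N) := by
  have : Cube.boundary N = ⋃ i : N, ({y | y i = 0} ∪ {y | y i = 1}) := by
    ext y; simp [Cube.boundary]
  rw [this]
  exact isClosed_iUnion_of_finite fun i =>
    (isClosed_eq (continuous_apply i) continuous_const).union
      (isClosed_eq (continuous_apply i) continuous_const)

variable (N) in
/-- **The cube `Iᴺ` as a ball chart** in `ℝᴺ` (sup norm), boundary `Cube.boundary N`.
[folklore] -/
def BallChart.cube : BallChart (N → I) (N → ℝ) where
  toFun := cubeToBall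
  invFun := ballToCube
  continuous_toFun := continuous_cubeToBall
  continuous_invFun := continuous_ballToCube
  left_inv := ballToCube_cubeToBall
  mem_closedBall := cubeToBall_mem_closedBall
  right_inv _ hv := cubeToBall_ballToCube hv
  boundary := Cube.boundary N
  mem_boundary_iff := mem_boundary_iff_norm_cubeToBall

/-- The boundary of the cube chart is `Cube.boundary N`. [folklore] -/
@[simp]
theorem BallChart.cube_boundary : (BallChart.cube N).boundary = Cube.boundary N := rfl

omit [Fintype N] in
/-- The boundary `GenLoopPath.cylBd N = {0, 1} × Iᴺ ∪ I × ∂Iᴺ` of the cylinder is closed, for `N`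
finite (supersedes `Literature.AlgebraicTopology.Homotopy.isClosed_cylBoundary` of
`HomotopyGroupsGeneralPosition.lean`, whose `cylBoundary` is definitionally `GenLoopPath.cylBd`;
dedup event 197556). [folklore] -/
theorem isClosed_cylBd [Finite N] : IsClosed (GenLoopPath.cylBd N) :=
  (isClosed_eq continuous_fst continuous_const).union
    ((isClosed_eq continuous_fst continuous_const).union
      (isClosed_cubeBoundary.preimage continuous_snd))

/-- The affine identification `I × Iᴺ → [-1, 1] × [-1, 1]ᴺ`. [folklore] -/
def cylToBall (p : I × (N → I)) : ℝ × (N → ℝ) := (2 * (p.1 : ℝ) - 1, cubeToBall p.2)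

/-- The clamped inverse `ℝ × ℝᴺ → I × Iᴺ` of `cylToBall`. [folklore] -/
def ballToCyl (q : ℝ × (N → ℝ)) : I × (N → I) :=
  (Set.projIcc (0 : ℝ) 1 zero_le_one ((q.1 + 1) / 2), ballToCube q.2)

variable (N) in
/-- **The cylinder `I × Iᴺ` as a ball chart** in `ℝ × ℝᴺ` (sup norm), boundary
`GenLoopPath.cylBd N`. [folklore] -/
def BallChart.cylinder : BallChart (I × (N → I)) (ℝ × (N → ℝ)) where
  toFun := cylToBall
  invFun := ballToCyl
  continuous_toFun := by unfold cylToBall; fun_prop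
  continuous_invFun := by
    unfold ballToCyl
    exact (continuous_projIcc.comp (by fun_prop)).prodMk (continuous_ballToCube.comp continuous_snd)
  left_inv p := by
    obtain ⟨s, y⟩ := p
    simp only [ballToCyl, cylToBall, ballToCube_cubeToBall, Prod.mk.injEq, and_true]
    apply Subtype.ext
    have h : (2 * (s : ℝ) - 1 + 1) / 2 = s := by ring
    simp only [h, Set.projIcc_val zero_le_one s]
  mem_closedBall p := by
    rw [mem_closedBall_zero_iff, cylToBall, Prod.norm_mk, max_le_iff]
    refine ⟨?_, mem_closedBall_zero_iff.1 (cubeToBall_mem_closedBall p.2)⟩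
    rw [Real.norm_eq_abs, abs_le]
    constructor <;> linarith [p.1.2.1, p.1.2.2]
  right_inv q hq := by
    obtain ⟨a, v⟩ := q
    rw [mem_closedBall_zero_iff, Prod.norm_mk, max_le_iff, Real.norm_eq_abs, abs_le] at hq
    have hmem : (a + 1) / 2 ∈ Icc (0 : ℝ) 1 := ⟨by linarith [hq.1.1], by linarith [hq.1.2]⟩
    simp only [cylToBall, ballToCyl, Set.projIcc_of_mem _ hmem,
      cubeToBall_ballToCube (mem_closedBall_zero_iff.2 hq.2), Prod.mk.injEq, and_true]
    ring
  boundary := GenLoopPath.cylBd N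
  mem_boundary_iff p := by
    obtain ⟨s, y⟩ := p
    rw [GenLoopPath.mem_cylBd, cylToBall, Prod.norm_mk]
    have hs : |2 * (s : ℝ) - 1| ≤ 1 := by
      rw [abs_le]; constructor <;> linarith [s.2.1, s.2.2]
    have hy : ‖cubeToBall y‖ ≤ 1 := mem_closedBall_zero_iff.1 (cubeToBall_mem_closedBall y)
    dsimp only
    rw [Real.norm_eq_abs]
    constructor
    · rintro (h | h | h)
      · subst h
        have h1 : |2 * ((0 : I) : ℝ) - 1| = 1 := by norm_num
        rw [h1]; exact max_eq_left hy
      · subst h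
        have h1 : |2 * ((1 : I) : ℝ) - 1| = 1 := by norm_num
        rw [h1]; exact max_eq_left hy
      · rw [(mem_boundary_iff_norm_cubeToBall y).1 h]
        exact max_eq_right hs
    · intro h
      rcases le_total |2 * (s : ℝ) - 1| ‖cubeToBall y‖ with hle | hle
      · rw [max_eq_right hle] at h
        exact Or.inr (Or.inr ((mem_boundary_iff_norm_cubeToBall y).2 h))
      · rw [max_eq_left hle] at h
        rcases (abs_eq zero_le_one).1 h with h' | h'
        · exact Or.inr (Or.inl (Subtype.ext (by rw [Icc.coe_one]; linarith)))
        · exact Or.inl (Subtype.ext (by rw [Icc.coe_zero]; linarith))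

/-- The boundary of the cylinder chart is `GenLoopPath.cylBd N`. [folklore] -/
@[simp]
theorem BallChart.cylinder_boundary : (BallChart.cylinder N).boundary = GenLoopPath.cylBd N := rfl

/-- **HEP for `(Iᴺ, ∂Iᴺ)`**: a map `φ : Iᴺ → Z` and a homotopy `h` of `φ|∂Iᴺ` (continuous on
`I × ∂Iᴺ`, starting at `φ`) extend to a homotopy of `φ` (Hatcher 2002, Prop. 0.16).
[cite: HatcherAT2002, Prop. 0.16] -/
theorem exists_extension_cube (φ : C(N → I, Z)) (h : I × (N → I) → Z)
    (hh : ContinuousOn h (univ ×ˢ Cube.boundary N))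
    (h0 : ∀ y ∈ Cube.boundary N, h (0, y) = φ y) :
    ∃ Φ : C(I × (N → I), Z), (∀ y, Φ (0, y) = φ y) ∧
      ∀ (t : I), ∀ y ∈ Cube.boundary N, Φ (t, y) = h (t, y) :=
  (BallChart.cube N).exists_extension φ h hh h0

/-- **HEP for the cylinder `(I × Iᴺ, ∂(I × Iᴺ))`**. [cite: HatcherAT2002, Prop. 0.16] -/
theorem exists_extension_cylinder (φ : C(I × (N → I), Z)) (h : I × (I × (N → I)) → Z)
    (hh : ContinuousOn h (univ ×ˢ GenLoopPath.cylBd N))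
    (h0 : ∀ p ∈ GenLoopPath.cylBd N, h (0, p) = φ p) :
    ∃ Φ : C(I × (I × (N → I)), Z), (∀ p, Φ (0, p) = φ p) ∧
      ∀ (r : I), ∀ p ∈ GenLoopPath.cylBd N, Φ (r, p) = h (r, p) :=
  (BallChart.cylinder N).exists_extension φ h hh h0

/-! ### Free homotopies with null-homotopic boundary track are homotopies rel `∂Iᴺ` -/

/-- **Free versus relative homotopy.** Let `u v : Iᴺ → Z` and let `Φ` be a free homotopy from
`u` to `v`. Suppose the track of `Φ` on the boundary is null-homotopic rel endpoints, in the
following concrete sense: there is `Λ : I × (I × Iᴺ) → Z` (deformation parameter `r`, then the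
point `(s, y)` of the cylinder), continuous on `I × ∂(I × Iᴺ)`, with `Λ (0, (s, y)) = Φ (s, y)`
and `Λ (1, (s, y)) = u y` for `y ∈ ∂Iᴺ`, and `Λ (r, (0, y)) = u y`, `Λ (r, (1, y)) = v y` for
all `y`. Then `u` and `v` are homotopic rel `∂Iᴺ` (in particular `u = v` on `∂Iᴺ`). Proof: one
application of the HEP of `(I × Iᴺ, ∂(I × Iᴺ))` to `Φ` and `Λ`; the far end `r = 1` of the
extension is the homotopy rel `∂Iᴺ`. This is the mechanism of Hatcher's change-of-basepoint
maps `β_γ` (§4.1, p. 341: "`β_γ` depends only on the homotopy class of `γ`"). The special case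
of a null-homotopy along a path (`v` constant, track `γ(t)` independent of `y`) is
`Literature.AlgebraicTopology.Homotopy.genLoop_homotopic_const_of_free` (`HomotopyGroupsGeneralPosition.lean`), proved there by
an explicit collar construction; use the present lemmas when both ends are non-constant.
[cite: HatcherAT2002, §4.1 p. 341] -/
theorem homotopicRel_of_freeHomotopy (u v : C(N → I, Z)) (Φ : C(I × (N → I), Z))
    (hΦ0 : ∀ y, Φ (0, y) = u y) (hΦ1 : ∀ y, Φ (1, y) = v y)
    (Λ : I × (I × (N → I)) → Z) (hΛ : ContinuousOn Λ (univ ×ˢ GenLoopPath.cylBd N))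
    (hΛ0 : ∀ s, ∀ y ∈ Cube.boundary N, Λ (0, (s, y)) = Φ (s, y))
    (hΛ1 : ∀ s, ∀ y ∈ Cube.boundary N, Λ (1, (s, y)) = u y)
    (hΛs0 : ∀ (r : I) (y : N → I), Λ (r, (0, y)) = u y)
    (hΛs1 : ∀ (r : I) (y : N → I), Λ (r, (1, y)) = v y) :
    u.HomotopicRel v (Cube.boundary N) := by
  have h0 : ∀ p ∈ GenLoopPath.cylBd N, Λ (0, p) = Φ p := by
    rintro ⟨s, y⟩ (hs | hs | hy)
    · dsimp only at hs; subst hs; rw [hΛs0, hΦ0]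
    · dsimp only at hs; subst hs; rw [hΛs1, hΦ1]
    · exact hΛ0 s y hy
  obtain ⟨Ψ, -, hΨ⟩ := exists_extension_cylinder Φ Λ hΛ h0
  refine ⟨{ toFun := fun p => Ψ (1, p)
            continuous_toFun := by fun_prop
            map_zero_left := fun y => ?_
            map_one_left := fun y => ?_
            prop' := fun s y hy => ?_ }⟩
  · show Ψ (1, (0, y)) = u y
    rw [hΨ 1 (0, y) (Or.inl rfl), hΛs0]
  · show Ψ (1, (1, y)) = v y
    rw [hΨ 1 (1, y) (Or.inr (Or.inl rfl)), hΛs1]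
  · show Ψ (1, (s, y)) = u y
    rw [hΨ 1 (s, y) (Or.inr (Or.inr hy)), hΛ1 s y hy]

/-- **Free versus relative homotopy, track form.** Let `Φ` be a free homotopy from `u` to `v`
(maps `Iᴺ → Z`) whose restriction to the boundary runs along a homotopy `γ` *and back*:
`Φ (s, y) = γ (θ s, y)` for `y ∈ ∂Iᴺ`, where `θ : I → I` is continuous with
`θ 0 = θ 1 = 0` and `γ (0, y) = u y` on `∂Iᴺ`. Then `u ≃ v rel ∂Iᴺ`: the track is
null-homotopic rel endpoints through `γ ((1 - r) θ s, y)`, and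
`homotopicRel_of_freeHomotopy` applies. [cite: HatcherAT2002, §4.1 p. 341] -/
theorem homotopicRel_of_freeHomotopy_track (u v : C(N → I, Z)) (Φ : C(I × (N → I), Z))
    (hΦ0 : ∀ y, Φ (0, y) = u y) (hΦ1 : ∀ y, Φ (1, y) = v y)
    (γ : C(I × (N → I), Z)) (θ : C(I, I)) (hθ0 : θ 0 = 0) (hθ1 : θ 1 = 0)
    (hγ0 : ∀ y ∈ Cube.boundary N, γ (0, y) = u y)
    (htrack : ∀ (s : I), ∀ y ∈ Cube.boundary N, Φ (s, y) = γ (θ s, y)) :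
    u.HomotopicRel v (Cube.boundary N) := by
  classical
  -- `u = v` on the boundary
  have huv : ∀ y ∈ Cube.boundary N, v y = u y := fun y hy => by
    rw [← hΦ1, htrack 1 y hy, hθ1, hγ0 y hy]
  -- the null-homotopy of the track, extended by `Φ` off the boundary
  set Λ : I × (I × (N → I)) → Z := fun q =>
    if q.2.2 ∈ Cube.boundary N then γ (unitInterval.symm q.1 * θ q.2.1, q.2.2) else Φ q.2 with hΛ
  have hcont : Continuous fun q : I × (I × (N → I)) =>
      γ (unitInterval.symm q.1 * θ q.2.1, q.2.2) := by
    refine γ.continuous.comp (Continuous.prodMk ?_ (continuous_snd.comp continuous_snd))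
    have h1 : Continuous fun q : I × (I × (N → I)) => ((unitInterval.symm q.1 : ℝ)) := by fun_prop
    have h2 : Continuous fun q : I × (I × (N → I)) => ((θ q.2.1 : I) : ℝ) := by fun_prop
    exact (h1.mul h2).subtype_mk _
  have hΛc : ContinuousOn Λ (univ ×ˢ GenLoopPath.cylBd N) := by
    -- three closed pieces: `s = 0`, `s = 1`, `y ∈ ∂Iᴺ`
    have hpiece : (univ : Set I) ×ˢ GenLoopPath.cylBd N =
        (univ ×ˢ {p : I × (N → I) | p.1 = 0} ∪ univ ×ˢ {p : I × (N → I) | p.1 = 1}) ∪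
          univ ×ˢ {p : I × (N → I) | p.2 ∈ Cube.boundary N} := by
      ext ⟨r, s, y⟩
      simp only [mem_prod, mem_univ, true_and, GenLoopPath.mem_cylBd, mem_setOf_eq, mem_union, or_assoc]
    rw [hpiece]
    have hcl0 : IsClosed ((univ : Set I) ×ˢ {p : I × (N → I) | p.1 = 0}) :=
      isClosed_univ.prod (isClosed_eq continuous_fst continuous_const)
    have hcl1 : IsClosed ((univ : Set I) ×ˢ {p : I × (N → I) | p.1 = 1}) :=
      isClosed_univ.prod (isClosed_eq continuous_fst continuous_const)
    have hclb : IsClosed ((univ : Set I) ×ˢ {p : I × (N → I) | p.2 ∈ Cube.boundary N}) := by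
      haveI : Finite N := Finite.of_fintype N
      exact isClosed_univ.prod (isClosed_cubeBoundary.preimage continuous_snd)
    refine (ContinuousOn.union_of_isClosed ?_ ?_ hcl0 hcl1).union_of_isClosed ?_ (hcl0.union hcl1) hclb
    · -- on `s = 0` the function is `u y`
      refine (u.continuous.comp (continuous_snd.comp continuous_snd)).continuousOn.congr ?_
      rintro ⟨r, s, y⟩ ⟨-, hs⟩
      simp only [mem_setOf_eq] at hs
      subst hs
      show (if y ∈ Cube.boundary N then γ (unitInterval.symm r * θ 0, y) else Φ (0, y)) = u y
      split_ifs with hy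
      · rw [hθ0, mul_zero, hγ0 y hy]
      · exact hΦ0 y
    · -- on `s = 1` the function is `v y`
      refine (v.continuous.comp (continuous_snd.comp continuous_snd)).continuousOn.congr ?_
      rintro ⟨r, s, y⟩ ⟨-, hs⟩
      simp only [mem_setOf_eq] at hs
      subst hs
      show (if y ∈ Cube.boundary N then γ (unitInterval.symm r * θ 1, y) else Φ (1, y)) = v y
      split_ifs with hy
      · rw [hθ1, mul_zero, hγ0 y hy, huv y hy]
      · exact hΦ1 y
    · -- on `y ∈ ∂Iᴺ` the function is the explicit null-homotopy
      refine hcont.continuousOn.congr ?_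
      rintro ⟨r, s, y⟩ ⟨-, hy⟩
      simp only [mem_setOf_eq] at hy
      show (if y ∈ Cube.boundary N then γ (unitInterval.symm r * θ s, y) else Φ (s, y)) = _
      rw [if_pos hy]
  refine homotopicRel_of_freeHomotopy u v Φ hΦ0 hΦ1 Λ hΛc ?_ ?_ ?_ ?_
  · intro s y hy
    show (if y ∈ Cube.boundary N then γ (unitInterval.symm 0 * θ s, y) else Φ (s, y)) = Φ (s, y)
    rw [if_pos hy, unitInterval.symm_zero, one_mul, htrack s y hy]
  · intro s y hy
    show (if y ∈ Cube.boundary N then γ (unitInterval.symm 1 * θ s, y) else Φ (s, y)) = u y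
    rw [if_pos hy, unitInterval.symm_one, zero_mul, hγ0 y hy]
  · intro r y
    show (if y ∈ Cube.boundary N then γ (unitInterval.symm r * θ 0, y) else Φ (0, y)) = u y
    split_ifs with hy
    · rw [hθ0, mul_zero, hγ0 y hy]
    · exact hΦ0 y
  · intro r y
    show (if y ∈ Cube.boundary N then γ (unitInterval.symm r * θ 1, y) else Φ (1, y)) = v y
    split_ifs with hy
    · rw [hθ1, mul_zero, hγ0 y hy, huv y hy]
    · exact hΦ1 y

/-- The tent `θ : I → I` of `homotopicRel_of_homotopies`: `4t` on `[0, 1/4]`, `1` on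
`[1/4, 1/2]`, `2 - 2t` on `[1/2, 1]` (the boundary track of `(A.symm.trans G).trans C.symm`
runs through `A` backwards at quadruple speed, rests, and returns at double speed). [folklore] -/
def tent : C(I, I) where
  toFun t := Set.projIcc 0 1 zero_le_one (min (4 * (t : ℝ)) (2 - 2 * (t : ℝ)))
  continuous_toFun := continuous_projIcc.comp (by fun_prop)

/-- `tent 0 = 0`. [folklore] -/
@[simp] theorem tent_zero : tent 0 = 0 := by
  apply Subtype.ext
  simp [tent, Set.projIcc]

/-- `tent 1 = 0`. [folklore] -/
@[simp] theorem tent_one : tent 1 = 0 := by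
  apply Subtype.ext
  norm_num [tent, Set.projIcc]

/-- The value of `tent` as a real number. [folklore] -/
theorem coe_tent (t : I) : (tent t : ℝ) = max 0 (min 1 (min (4 * (t : ℝ)) (2 - 2 * (t : ℝ)))) := by
  simp [tent, Set.projIcc]

/-- **Three homotopies with a common boundary track give a homotopy rel `∂Iᴺ`.** If `A` is a
homotopy from `w₁` to `u`, `G` a homotopy rel `∂Iᴺ` from `w₁` to `w₂`, and `C` a homotopy from
`w₂` to `v`, and `A` and `C` agree on `I × ∂Iᴺ`, then `u ≃ v rel ∂Iᴺ`: the free homotopy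
`A⁻¹ · G · C` from `u` to `v` has boundary track `A⁻¹ · const · A`, null rel endpoints
(`homotopicRel_of_freeHomotopy_track` with `γ = A` reversed and `θ = tent`). This is the form in
which change of basepoint is used (Hatcher 2002, §4.1, p. 341). [cite: HatcherAT2002, §4.1 p. 341] -/
theorem homotopicRel_of_homotopies {u v w₁ w₂ : C(N → I, Z)} (A : w₁.Homotopy u)
    (G : w₁.HomotopyRel w₂ (Cube.boundary N)) (C : w₂.Homotopy v)
    (hAC : ∀ (s : I), ∀ y ∈ Cube.boundary N, A (s, y) = C (s, y)) :
    u.HomotopicRel v (Cube.boundary N) := by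
  set Φ : u.Homotopy v := (A.symm.trans G.toHomotopy).trans C with hΦ
  -- `γ (s, y) = A (1 - s, y)`
  set γ : C(I × (N → I), Z) := ⟨fun p => A (unitInterval.symm p.1, p.2), by fun_prop⟩ with hγ
  refine homotopicRel_of_freeHomotopy_track u v Φ.toContinuousMap (fun y => Φ.apply_zero y)
    (fun y => Φ.apply_one y) γ tent tent_zero tent_one (fun y _ => ?_) (fun s y hy => ?_)
  · show A (unitInterval.symm 0, y) = u y
    rw [unitInterval.symm_zero, A.apply_one]
  · -- compute the track of `Φ` on the boundary
    have hw₁ : A (0, y) = w₁ y := A.apply_zero y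
    have hGy : ∀ t, G (t, y) = w₁ y := fun t => G.eq_fst t hy
    show ((A.symm.trans G.toHomotopy).trans C) (s, y) = A (unitInterval.symm (tent s), y)
    have hs0 : (0 : ℝ) ≤ s := s.2.1
    have hs1 : (s : ℝ) ≤ 1 := s.2.2
    have key : ∀ (a : I), (a : ℝ) = max 0 (min 1 (min (4 * (s : ℝ)) (2 - 2 * (s : ℝ)))) →
        ((A.symm.trans G.toHomotopy).trans C) (s, y) = A (unitInterval.symm a, y) := by
      intro a ha
      rw [ContinuousMap.Homotopy.trans_apply]
      split_ifs with h1
      · have h1' : (s : ℝ) ≤ 1 / 2 := h1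
        rw [ContinuousMap.Homotopy.trans_apply]
        split_ifs with h2
        · -- first quarter: `A` backwards at quadruple speed
          have h2' : 2 * (s : ℝ) ≤ 1 / 2 := h2
          have e3 : min (4 * (s : ℝ)) (2 - 2 * s) = 4 * s := min_eq_left (by linarith)
          have e2 : min (1 : ℝ) (min (4 * s) (2 - 2 * s)) = 4 * s := by
            rw [e3]; exact min_eq_right (by linarith)
          have ha' : (a : ℝ) = 4 * s := by rw [ha, e2]; exact max_eq_right (by linarith)
          rw [ContinuousMap.Homotopy.symm_apply]
          congr 2
          apply Subtype.ext
          rw [unitInterval.coe_symm_eq, unitInterval.coe_symm_eq, ha']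
          simp only []
          ring
        · -- second quarter: `G`, constant on the boundary
          have h2' : ¬ 2 * (s : ℝ) ≤ 1 / 2 := h2
          have e3 : min (1 : ℝ) (min (4 * s) (2 - 2 * s)) = 1 :=
            min_eq_left (le_min (by linarith) (by linarith))
          have ha' : (a : ℝ) = 1 := by rw [ha, e3]; exact max_eq_right zero_le_one
          have ha1 : unitInterval.symm a = 0 := by
            apply Subtype.ext
            rw [unitInterval.coe_symm_eq, ha', Icc.coe_zero, sub_self]
          change G (_, y) = _
          rw [hGy, ha1, hw₁]
      · -- second half: `C` at double speed, equal to `A` on the boundary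
        have h1' : ¬ (s : ℝ) ≤ 1 / 2 := h1
        have e3 : min (4 * (s : ℝ)) (2 - 2 * s) = 2 - 2 * s := min_eq_right (by linarith)
        have e2 : min (1 : ℝ) (min (4 * s) (2 - 2 * s)) = 2 - 2 * s := by
          rw [e3]; exact min_eq_right (by linarith)
        have ha' : (a : ℝ) = 2 - 2 * s := by rw [ha, e2]; exact max_eq_right (by linarith)
        rw [← hAC _ y hy]
        congr 2
        apply Subtype.ext
        rw [unitInterval.coe_symm_eq, ha']
        simp only []
        ring
    exact key (tent s) (coe_tent s)

end Cube

end CubeHEP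

end Literature.AlgebraicTopology.Homotopy

end
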